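import Mathlib

/-!
# `UnimodularTypesAgree` — the lattice lemma (i) of card `unimodular-relator-reduction` (support P2)

Crux stmt-SmoothPoincare4-10507 (`ConvexBisection.AcyclicBisectionRigidity`), route
`route-SmoothPoincare4-ConvexBisection`; line lead a2.  Idea card
`Cruxes/AcyclicBisectionRigidity/Ideas/unimodular-relator-reduction.md`, §"What it needs" P2 ("the lattice
lemma — `UnimodularTypesAgree` (O(n,ℤ) = signed permutations) …, support, provable now"); stated as
`UnimodularTypesAgree` in the ideator's first-lemma file `Cruxes/AcyclicBisectionRigidity/IdeasSketchR2I5g2.lean`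
(the payload "line" `Sketch`, which is that file and has no composition), proved here with its `IsZeroOne`
hypothesis unfolded (Cruxes files are not importable from `Theorems/`).

Content.  For planar pages the TYPE of a vanishing cycle of a minimal positive factorisation `F` is a row of
its `0/1` hole-incidence matrix `M_F`, and `M_Fᵀ M_F` is an invariant of the monodromy (the disprover's
pair-separation counts, `Cruxes/…/Disproof.lean` §13c).  The lemma: two `0/1` integer `n × n` matrices `A`, `B`
with `Aᵀ A = Bᵀ B` and `det A = ±1` (ℤHS seam) have the same rows up to a permutation — so on the unimodular
sector every type count of `F·F̄′` vanishes and the type obstruction to monotone achiral reducibility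
(`Disproof.lean` §13c `not_monotoneReducible_of_typeCount_ne_zero`) is silent; together with the ideator's
`rows_not_perm_of_span_ne` it places the lever `T` exactly on the unimodular sector.

Proof.  `Q = B A⁻¹` is an integer matrix with `Qᵀ Q = 1`, hence `Q Qᵀ = 1`, so every row of `Q` has exactly
one non-zero entry, equal to `±1`; then row `j` of `B = Q A` is `±` row `π j` of `A`; both are non-zero
`0/1` vectors (`det A ≠ 0`), so the sign is `+`; and `π` is injective because `det B = ± det A ≠ 0`
forbids two equal rows.  Mathlib only; no definitions, no named facts, no `sorry`.
-/

-- The namespace is prescribed by the crux protocol (`Summit.<P>.<Sub>.Theorems.<Crux>` with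
-- `P = Sub = SmoothPoincare4`), hence the duplicated component.
set_option linter.dupNamespace false

namespace Summit.SmoothPoincare4.SmoothPoincare4.Theorems.AcyclicBisectionRigidity

open Matrix Finset

/-- **Rows of an integer matrix with `Q * Qᵀ = 1` are signed unit vectors.**  For every row index `j`
there is a column `i₀` with `Q j i₀ = ±1` and `Q j i = 0` for `i ≠ i₀` (the diagonal entry
`∑ i, Q j i ^ 2 = 1` is a sum of non-negative integers). [folklore] -/
theorem helper_unimodularTypesAgree_row {n : ℕ} (Q : Matrix (Fin n) (Fin n) ℤ)
    (hQ : Q * Matrix.transpose Q = 1) (j : Fin n) :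
    ∃ i₀, (Q j i₀ = 1 ∨ Q j i₀ = -1) ∧ ∀ i, i ≠ i₀ → Q j i = 0 := by
  have hdiag : ∑ i, Q j i * Q j i = 1 := by
    have h := congrFun (congrFun hQ j) j
    simpa [Matrix.mul_apply, Matrix.transpose_apply] using h
  obtain ⟨i₀, -, hi₀⟩ : ∃ i₀ ∈ (Finset.univ : Finset (Fin n)), Q j i₀ * Q j i₀ ≠ 0 := by
    apply Finset.exists_ne_zero_of_sum_ne_zero
    rw [hdiag]
    exact one_ne_zero
  have hnonneg : ∀ i, 0 ≤ Q j i * Q j i := fun i => mul_self_nonneg _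
  have hsplit : Q j i₀ * Q j i₀ + ∑ i ∈ Finset.univ.erase i₀, Q j i * Q j i = 1 := by
    rw [← hdiag]
    exact Finset.add_sum_erase Finset.univ (fun i => Q j i * Q j i) (Finset.mem_univ i₀)
  have hrest_nonneg : 0 ≤ ∑ i ∈ Finset.univ.erase i₀, Q j i * Q j i :=
    Finset.sum_nonneg fun i _ => hnonneg i
  have hne : Q j i₀ ≠ 0 := fun h => hi₀ (by rw [h, mul_zero])
  have habs : 1 ≤ |Q j i₀| := Int.one_le_abs hne
  have hge : 1 ≤ Q j i₀ * Q j i₀ := by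
    rw [← abs_mul_abs_self]
    nlinarith
  have hsq : Q j i₀ * Q j i₀ = 1 := le_antisymm (by linarith) hge
  have hrest : ∑ i ∈ Finset.univ.erase i₀, Q j i * Q j i = 0 := by linarith
  refine ⟨i₀, mul_self_eq_one_iff.mp hsq, fun i hi => ?_⟩
  have hmem : i ∈ Finset.univ.erase i₀ := Finset.mem_erase.mpr ⟨hi, Finset.mem_univ i⟩
  exact mul_self_eq_zero.mp ((Finset.sum_eq_zero_iff_of_nonneg fun k _ => hnonneg k).mp hrest i hmem)

/-- **Unimodular types agree** (card `unimodular-relator-reduction`, lattice lemma (i); the ideator's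
`UnimodularTypesAgree` with `IsZeroOne` unfolded).  Two `0/1` integer `n × n` matrices with equal Gram
matrices `Aᵀ A = Bᵀ B` and `det A` a unit have the same multiset of rows: `B i = A (σ i)` for a permutation
`σ` of the row indices.  (`B A⁻¹ ∈ O(n, ℤ)` is a signed permutation matrix; non-zero `0/1` rows fix the
signs; `det B ≠ 0` makes the row map injective.) [folklore] -/
theorem helper_unimodularTypesAgree :
    ∀ (n : ℕ) (A B : Matrix (Fin n) (Fin n) ℤ), (∀ i j, A i j = 0 ∨ A i j = 1) →
      (∀ i j, B i j = 0 ∨ B i j = 1) → Matrix.transpose A * A = Matrix.transpose B * B →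
      IsUnit A.det → ∃ σ : Equiv.Perm (Fin n), ∀ i, B i = A (σ i) := by
  intro n A B hA hB hG hdet
  -- `Q := B * A⁻¹` satisfies `Q * A = B` and is orthogonal.
  set Q : Matrix (Fin n) (Fin n) ℤ := B * A⁻¹ with hQdef
  have hAinv : A * A⁻¹ = 1 := Matrix.mul_nonsing_inv A hdet
  have hinvA : A⁻¹ * A = 1 := Matrix.nonsing_inv_mul A hdet
  have hQA : Q * A = B := by rw [hQdef, Matrix.mul_assoc, hinvA, Matrix.mul_one]
  have hQtQ : Matrix.transpose Q * Q = 1 := by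
    have h1 : Matrix.transpose Q * Q =
        Matrix.transpose A⁻¹ * (Matrix.transpose B * B) * A⁻¹ := by
      rw [hQdef, Matrix.transpose_mul]
      simp only [Matrix.mul_assoc]
    rw [h1, ← hG]
    calc Matrix.transpose A⁻¹ * (Matrix.transpose A * A) * A⁻¹
        = Matrix.transpose (A * A⁻¹) * (A * A⁻¹) := by
          rw [Matrix.transpose_mul]
          simp only [Matrix.mul_assoc]
      _ = 1 := by rw [hAinv, Matrix.transpose_one, Matrix.mul_one]
  have hQQt : Q * Matrix.transpose Q = 1 := mul_eq_one_comm.mp hQtQ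
  -- `det B ≠ 0`.
  have hdetB : B.det ≠ 0 := by
    have h1 : (Matrix.transpose B * B).det = (Matrix.transpose A * A).det := by rw [hG]
    rw [Matrix.det_mul, Matrix.det_mul, Matrix.det_transpose, Matrix.det_transpose] at h1
    intro h0
    rw [h0, mul_zero] at h1
    exact mul_ne_zero hdet.ne_zero hdet.ne_zero h1.symm
  -- The row map `π`: row `j` of `Q` is `± e_{π j}`.
  choose π hπ using helper_unimodularTypesAgree_row Q hQQt
  have hrow : ∀ j, B j = A (π j) := by
    intro j
    obtain ⟨hsign, hzero⟩ := hπ j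
    have hBj : ∀ k, B j k = Q j (π j) * A (π j) k := by
      intro k
      rw [← hQA, Matrix.mul_apply, Finset.sum_eq_single (π j)]
      · intro i _ hi
        rw [hzero i hi, zero_mul]
      · intro h
        exact absurd (Finset.mem_univ _) h
    rcases hsign with h1 | h1
    · ext k
      rw [hBj k, h1, one_mul]
    · exfalso
      -- row `π j` of the invertible matrix `A` is non-zero, so some entry is `1` and `B j` has a `-1`.
      obtain ⟨k, hk⟩ : ∃ k, A (π j) k ≠ 0 := by
        by_contra hcon
        push Not at hcon
        exact hdet.ne_zero (Matrix.det_eq_zero_of_row_eq_zero (π j) hcon)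
      have hAk : A (π j) k = 1 := (hA (π j) k).resolve_left hk
      have hBk : B j k = -1 := by rw [hBj k, h1, hAk]; norm_num
      rcases hB j k with h | h <;> rw [hBk] at h <;> norm_num at h
  -- `π` is injective (two equal rows would kill `det B`), hence a permutation.
  have hπinj : Function.Injective π := by
    intro j j' hjj'
    by_contra hne
    exact hdetB (Matrix.det_zero_of_row_eq hne (by rw [hrow j, hrow j', hjj']))
  refine ⟨Equiv.ofBijective π (Finite.injective_iff_bijective.mp hπinj), fun i => ?_⟩
  rw [Equiv.ofBijective_apply]
  exact hrow i

end Summit.SmoothPoincare4.SmoothPoincare4.Theorems.AcyclicBisectionRigidity
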